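import Summits.CriticalPhenomena.PercolationContinuityZ3.Theorems.PercNearOneGluingNoHeavyQuantThreePortHCollar
import HarnessLib

/-!
# `Z(3,2)` at every three-port observer from the THREE-CLUSTER PRODUCT ROW `P(a↔b↔c)·P(b↮c) ≤ 2·P(a joined to exactly one of b,c)`

builds on p205010 (kernel theorem, internal audit signed; external expert review pending)

Support file (`--supports stmt-CriticalPhenomena-4575`), seat `prim-quant-p1` (gen 39); memo
`run/shared/lean/prim/quant/prim-quant-p1-g39/FOR-LEAD-Z32-HCOLLAR.md` §7.  No definitions, no named facts, no sorries; standard axioms.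

The linear three-cluster row H_κ of p1 g38 (`κ·P(a att)·P(b↮c) ≤ P(exactly one)`, cells: `κ(S+U3)(S+U0) ≤ S`, `S = Uab+Uac`) is a
ratio of sums.  A cleaner BILINEAR form with the same content is the PRODUCT ROW
  (Π_C, apex `a`)   `U3 · (U0 + Uab + Uac) ≤ C · (Uab + Uac)`,  i.e.  `P(a ↔ b ↔ c) · P(b ↮ c) ≤ C · P(|C_a ∩ {b,c}| = 1)`
— the probability of an increasing event times that of a decreasing event bounded by a constant times the probability of the
(non-monotone) "exactly one" event, the shape of a two-configuration surgery.  Since `(S+U3)(S+U0) = S(S+U0) + U3(S+U0) ≤ S + C·S`,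
Π_C implies H_κ with `κ = 1/(1+C)` (`hRow_of_productRow`); so **Π₂ at the three apexes gives `Z(3,2)` at every three-port observer**
(`le_one_reached_le_of_productRow`, via `le_one_reached_le_of_H` at `κ = 1/3`).  Census (kit j287633, all graphs on ≤ 6 vertices ×
palettes + random weighted graphs on 7, 8 vertices, 3.4·10⁵ apex laws): `sup U3·P(b↮c)/S = 1.134`; gluing `b–c` at weight `1−ε` turns
the H-ratio of the graph without that edge into Π's ratio, so `sup ≥ 1/κ* ≈ 1.197` (hub family); conjecture: Π_C holds with `C = 6/5`,
and `C = 2` is what the three-port theorem needs.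
-/

noncomputable section

namespace Summit.CriticalPhenomena.PercolationContinuityZ3.Theorems

open MeasureTheory Set Literature.Probability.LatticeModels Literature.Probability.Percolation
open scoped Classical BigOperators

variable {n : ℕ}

namespace ThreePort

/-- The product row Π_C with `C ≤ 2` implies the linear row H_{1/3}: `(S+U3)(S+U0) = S(S+U0) + U3(S+U0) ≤ S + 2S`
(`Uab, Uac, Ubc, U3 ≥ 0`, cells summing to `1`, so `S + U0 ≤ 1`). [this work] -/
theorem hRow_of_productRow (C U0 Uab Uac Ubc U3 : ℝ) (hC : C ≤ 2) (hab : 0 ≤ Uab) (hac : 0 ≤ Uac)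
    (hbc : 0 ≤ Ubc) (h3 : 0 ≤ U3) (hsum : Uab + Uac + Ubc + U3 + U0 = 1)
    (hP : U3 * (U0 + Uab + Uac) ≤ C * (Uab + Uac)) :
    1 / 3 * (Uab + Uac + U3) * (U0 + Uab + Uac) ≤ Uab + Uac := by
  have h1 : (Uab + Uac) * (U0 + Uab + Uac) ≤ Uab + Uac := by
    have : U0 + Uab + Uac ≤ 1 := by linarith only [hsum, hbc, h3]
    nlinarith only [this, hab, hac]
  have h2 : U3 * (U0 + Uab + Uac) ≤ 2 * (Uab + Uac) := by nlinarith only [hP, hC, hab, hac]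
  nlinarith only [h1, h2]

/-- **`Z(3,2)` at every three-port observer from the three-cluster product row Π_C, `C ≤ 2`.**  Let `o` be a three-port observer onto
`a, b, c` of an arbitrary finite weighted graph whose off-`o` three-point law of `(a,b,c)` satisfies, at each apex `v ∈ {a,b,c}`,
`P(a↔b↔c) · P(u ↮ w) ≤ C · P(v joined to exactly one of u, w)` (`{u,w}` the other two; connections in `ω ∖ {edges at o}`).
If `Σ_v μ(o↔v) > 2` and `t ≥ μ(o↮v)` (`v = a,b,c`) then `μ{o reaches at most one of a,b,c} ≤ t`. [this work] -/
theorem le_one_reached_le_of_productRow (C : ℝ) (hC : C ≤ 2) (w : Sym2 (Fin n) → unitInterval) (R : Finset (Fin n))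
    (o a b c : Fin n) (t : ℝ)
    (hR : R = {a, b, c}) (hao : a ≠ o) (hbo : b ≠ o) (hco : c ≠ o) (hab : a ≠ b) (hac : a ≠ c) (hbc : b ≠ c)
    (hobs : ∀ u, u ≠ o → u ≠ a → u ≠ b → u ≠ c → w s(o, u) = 0)
    (hPa : (prodBernoulli w).real {ω | (openGraph (ω ∩ {e | o ∉ e})).Reachable a b ∧ (openGraph (ω ∩ {e | o ∉ e})).Reachable a c} *
      ((prodBernoulli w).real {ω | ¬ (openGraph (ω ∩ {e | o ∉ e})).Reachable a b ∧ ¬ (openGraph (ω ∩ {e | o ∉ e})).Reachable a c ∧ ¬ (openGraph (ω ∩ {e | o ∉ e})).Reachable b c} +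
        (prodBernoulli w).real {ω | (openGraph (ω ∩ {e | o ∉ e})).Reachable a b ∧ ¬ (openGraph (ω ∩ {e | o ∉ e})).Reachable a c} +
        (prodBernoulli w).real {ω | (openGraph (ω ∩ {e | o ∉ e})).Reachable a c ∧ ¬ (openGraph (ω ∩ {e | o ∉ e})).Reachable a b}) ≤
      C * ((prodBernoulli w).real {ω | (openGraph (ω ∩ {e | o ∉ e})).Reachable a b ∧ ¬ (openGraph (ω ∩ {e | o ∉ e})).Reachable a c} +
        (prodBernoulli w).real {ω | (openGraph (ω ∩ {e | o ∉ e})).Reachable a c ∧ ¬ (openGraph (ω ∩ {e | o ∉ e})).Reachable a b}))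
    (hPb : (prodBernoulli w).real {ω | (openGraph (ω ∩ {e | o ∉ e})).Reachable a b ∧ (openGraph (ω ∩ {e | o ∉ e})).Reachable a c} *
      ((prodBernoulli w).real {ω | ¬ (openGraph (ω ∩ {e | o ∉ e})).Reachable a b ∧ ¬ (openGraph (ω ∩ {e | o ∉ e})).Reachable a c ∧ ¬ (openGraph (ω ∩ {e | o ∉ e})).Reachable b c} +
        (prodBernoulli w).real {ω | (openGraph (ω ∩ {e | o ∉ e})).Reachable a b ∧ ¬ (openGraph (ω ∩ {e | o ∉ e})).Reachable a c} +
        (prodBernoulli w).real {ω | (openGraph (ω ∩ {e | o ∉ e})).Reachable b c ∧ ¬ (openGraph (ω ∩ {e | o ∉ e})).Reachable a b}) ≤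
      C * ((prodBernoulli w).real {ω | (openGraph (ω ∩ {e | o ∉ e})).Reachable a b ∧ ¬ (openGraph (ω ∩ {e | o ∉ e})).Reachable a c} +
        (prodBernoulli w).real {ω | (openGraph (ω ∩ {e | o ∉ e})).Reachable b c ∧ ¬ (openGraph (ω ∩ {e | o ∉ e})).Reachable a b}))
    (hPc : (prodBernoulli w).real {ω | (openGraph (ω ∩ {e | o ∉ e})).Reachable a b ∧ (openGraph (ω ∩ {e | o ∉ e})).Reachable a c} *
      ((prodBernoulli w).real {ω | ¬ (openGraph (ω ∩ {e | o ∉ e})).Reachable a b ∧ ¬ (openGraph (ω ∩ {e | o ∉ e})).Reachable a c ∧ ¬ (openGraph (ω ∩ {e | o ∉ e})).Reachable b c} +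
        (prodBernoulli w).real {ω | (openGraph (ω ∩ {e | o ∉ e})).Reachable a c ∧ ¬ (openGraph (ω ∩ {e | o ∉ e})).Reachable a b} +
        (prodBernoulli w).real {ω | (openGraph (ω ∩ {e | o ∉ e})).Reachable b c ∧ ¬ (openGraph (ω ∩ {e | o ∉ e})).Reachable a b}) ≤
      C * ((prodBernoulli w).real {ω | (openGraph (ω ∩ {e | o ∉ e})).Reachable a c ∧ ¬ (openGraph (ω ∩ {e | o ∉ e})).Reachable a b} +
        (prodBernoulli w).real {ω | (openGraph (ω ∩ {e | o ∉ e})).Reachable b c ∧ ¬ (openGraph (ω ∩ {e | o ∉ e})).Reachable a b}))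
    (hsum : 2 < (prodBernoulli w).real (openConn o a) + (prodBernoulli w).real (openConn o b) +
      (prodBernoulli w).real (openConn o c))
    (hta : (prodBernoulli w).real (openConn o a)ᶜ ≤ t) (htb : (prodBernoulli w).real (openConn o b)ᶜ ≤ t)
    (htc : (prodBernoulli w).real (openConn o c)ᶜ ≤ t) :
    (prodBernoulli w).real {ω : BondConfig (Fin n) | (R.filter fun v => ω ∈ openConn o v).card ≤ 1} ≤ t := by
  set μ := prodBernoulli w with hμ
  set Uab := μ.real {ω | (openGraph (ω ∩ {e | o ∉ e})).Reachable a b ∧ ¬ (openGraph (ω ∩ {e | o ∉ e})).Reachable a c} with hUab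
  set Uac := μ.real {ω | (openGraph (ω ∩ {e | o ∉ e})).Reachable a c ∧ ¬ (openGraph (ω ∩ {e | o ∉ e})).Reachable a b} with hUac
  set Ubc := μ.real {ω | (openGraph (ω ∩ {e | o ∉ e})).Reachable b c ∧ ¬ (openGraph (ω ∩ {e | o ∉ e})).Reachable a b} with hUbc
  set U3 := μ.real {ω | (openGraph (ω ∩ {e | o ∉ e})).Reachable a b ∧ (openGraph (ω ∩ {e | o ∉ e})).Reachable a c} with hU3
  set U0 := μ.real {ω | ¬ (openGraph (ω ∩ {e | o ∉ e})).Reachable a b ∧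
    ¬ (openGraph (ω ∩ {e | o ∉ e})).Reachable a c ∧ ¬ (openGraph (ω ∩ {e | o ∉ e})).Reachable b c} with hU0
  have hcells : Uab + Uac + Ubc + U3 + U0 = 1 := cells_sum_eq_one w o a b c
  have hab' : 0 ≤ Uab := measureReal_nonneg
  have hac' : 0 ≤ Uac := measureReal_nonneg
  have hbc' : 0 ≤ Ubc := measureReal_nonneg
  have h3 : 0 ≤ U3 := measureReal_nonneg
  have hHa : 1 / 3 * (Uab + Uac + U3) * (U0 + Uab + Uac) ≤ Uab + Uac :=
    hRow_of_productRow C U0 Uab Uac Ubc U3 hC hab' hac' hbc' h3 hcells hPa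
  have hHb : 1 / 3 * (Uab + Ubc + U3) * (U0 + Uab + Ubc) ≤ Uab + Ubc :=
    hRow_of_productRow C U0 Uab Ubc Uac U3 hC hab' hbc' hac' h3 (by linarith only [hcells]) hPb
  have hHc : 1 / 3 * (Uac + Ubc + U3) * (U0 + Uac + Ubc) ≤ Uac + Ubc :=
    hRow_of_productRow C U0 Uac Ubc Uab U3 hC hac' hbc' hab' h3 (by linarith only [hcells]) hPc
  exact le_one_reached_le_of_H (1 / 3) le_rfl w R o a b c t hR hao hbo hco hab hac hbc hobs hHa hHb hHc hsum hta htb htc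

end ThreePort

end Summit.CriticalPhenomena.PercolationContinuityZ3.Theorems

end
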